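import Literature.Analysis.Fourier.RadialSchwartzInterpolationSuperposition
import Literature.Analysis.Fourier.RadialSchwartzInterpolationProofs
import Literature.Analysis.Fourier.RadialSchwartzInterpolationFlatSqrt
import Literature.Analysis.Fourier.RadialSchwartzInterpolationFourierDecay
import Mathlib.Analysis.SpecialFunctions.SmoothTransition
import Mathlib.Analysis.Calculus.Deriv.Polynomial
import Mathlib.Analysis.Calculus.ContDiff.Polynomial
import Mathlib.Analysis.Complex.RealDeriv
import HarnessLib

/-!
# CKMRV interpolation, step 4: compactly supported radial functions are Gaussian superpositions

Sibling of `Literature/Analysis/Fourier/RadialSchwartzInterpolation.lean` (the named fact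
`CKMRV2022_interpolationFormula` = Cohn–Kumar–Miller–Radchenko–Viazovska, Ann. Math. 196 (2022),
Theorem 1.7). In the proof of CKMRV Lemma 2.2 every compactly supported smooth radial `f` on `ℝᵈ`
is written as "`f(x) = g(|x|²) e^{−πy|x|²}` where `g` is a smooth, compactly supported function on
`ℝ`", and then, by Fourier inversion on `ℝ`, as the superposition of complex Gaussians
`f(x) = ∫ ĝ(t) e^{πi(2t+iy)|x|²} dt`. We prove the quantitative finite-smoothness version used in
the density-free form of the last step of the proof of Theorem 3.1
(`exists_gaussSup_eq`): for every compactly supported radial Schwartz `f`, every `y > 0` and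
every `k`, there is an integrable weight `w` with `∫ (1+|t|)ᵏ |w(t)| dt < ∞` and
`f = gaussSup w y = ∫ w(t) e^{πi(2t+iy)|·|²} dt`.

The smoothness of `s ↦ f(√s e₀)` at `s = 0` (Whitney's even-function lemma, CKMRV Lemma 2.1) is
needed only to finite order: we subtract from the even profile `φ(r) = f(r e₀)` its even Taylor
polynomial `P(r²)` (`exists_polynomial_sub_flat`), so that `ρ = φ − P(r²)` is flat and
`s ↦ ρ(√s)` is `C^m` (`contDiff_comp_sqrt_of_flat`, file `…FlatSqrt`), and set
`H(s) = e^{πys} (θ(s) P(s) + ρ(√s))` with a smooth cut-off `θ` (`= 1` on `s ≥ 0`, `= 0` on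
`s ≤ −1`); then `H ∈ C^m_c(ℝ)`, `H(|x|²) = e^{πy|x|²} f(x)`, and `w = Ĥ` works (file
`…FourierDecay`).

Everything is proved (theorems only); no named facts.

## References

* H. Cohn, A. Kumar, S. D. Miller, D. Radchenko, M. Viazovska, *Universal optimality of the `E₈`
  and Leech lattices and interpolation formulas*, Ann. of Math. 196 (2022) 983–1082,
  arXiv:1902.05438: §2.3, Lemma 2.1 and the proof of Lemma 2.2. [CohnEtAl2019]
-/

noncomputable section

open scoped Topology ContDiff FourierTransform Polynomial SchwartzMap
open Filter Set MeasureTheory Complex Polynomial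

namespace Literature.Analysis.Fourier

/-! ## Even functions: odd derivatives vanish; the even Taylor split -/

/-- The odd-order derivatives of an even function vanish at `0`. [folklore] -/
theorem iteratedDeriv_eq_zero_of_even {φ : ℝ → ℂ} (heven : ∀ r, φ (-r) = φ r) {j : ℕ}
    (hj : Odd j) : iteratedDeriv j φ 0 = 0 := by
  have h := iteratedDeriv_comp_neg j φ 0
  have hfun : (fun x => φ (-x)) = φ := funext heven
  rw [hfun, neg_zero, hj.neg_one_pow, neg_one_smul] at h
  have h2 : iteratedDeriv j φ 0 + iteratedDeriv j φ 0 = 0 := by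
    nth_rewrite 2 [h]
    exact add_neg_cancel _
  linear_combination h2 / 2

/-- Real iterated derivatives of `r ↦ p(r)` for a complex polynomial `p` restricted to the real line:
`(p ∘ ofReal)⁽ʲ⁾ = p⁽ʲ⁾ ∘ ofReal`. [folklore] -/
theorem iteratedDeriv_polynomial_eval_ofReal (p : ℂ[X]) (j : ℕ) :
    iteratedDeriv j (fun r : ℝ => p.eval (r : ℂ)) = fun r : ℝ => (derivative^[j] p).eval (r : ℂ) := by
  induction j generalizing p with
  | zero => simp
  | succ j ih =>
      rw [iteratedDeriv_succ', Function.iterate_succ_apply]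
      have hd : deriv (fun r : ℝ => p.eval (r : ℂ)) = fun r : ℝ => (derivative p).eval (r : ℂ) := by
        funext r
        exact ((p.hasDerivAt (r : ℂ)).comp_ofReal).deriv
      rw [hd, ih]

/-- … evaluated at `0`: `(p ∘ ofReal)⁽ʲ⁾(0) = j! · coeff_j(p)`. [folklore] -/
theorem iteratedDeriv_polynomial_eval_ofReal_zero (p : ℂ[X]) (j : ℕ) :
    iteratedDeriv j (fun r : ℝ => p.eval (r : ℂ)) 0 = (j.factorial : ℂ) * p.coeff j := by
  rw [iteratedDeriv_polynomial_eval_ofReal]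
  simp only [Complex.ofReal_zero]
  rw [← Polynomial.coeff_zero_eq_eval_zero, Polynomial.coeff_iterate_derivative, zero_add,
    Nat.descFactorial_self, nsmul_eq_mul]

/-- `r ↦ p(r)` on the real line is (real-)smooth. [folklore] -/
theorem contDiff_polynomial_eval_ofReal (p : ℂ[X]) {n : ℕ∞} :
    ContDiff ℝ n (fun r : ℝ => p.eval (r : ℂ)) :=
  ((Polynomial.contDiff_aeval p n).restrict_scalars ℝ).comp Complex.ofRealCLM.contDiff

/-- `r ↦ p(r²)` on the real line is smooth. [folklore] -/
theorem contDiff_polynomial_eval_ofReal_sq (p : ℂ[X]) {n : ℕ∞} :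
    ContDiff ℝ n (fun r : ℝ => p.eval ((r : ℂ) ^ 2)) :=
  ((Polynomial.contDiff_aeval p n).restrict_scalars ℝ).comp (Complex.ofRealCLM.contDiff.pow 2)

/-- **Even Taylor split.** For a smooth even `φ : ℝ → ℂ` and `K ∈ ℕ` there is a complex polynomial
`P` (the even Taylor polynomial, `P(s) = ∑_{k<K} φ⁽²ᵏ⁾(0) sᵏ/(2k)!`) such that
`ρ(r) = φ(r) − P(r²)` has `ρ⁽ʲ⁾(0) = 0` for all `j < 2K` (odd orders by evenness, even orders by
construction). [folklore] -/
theorem exists_polynomial_sub_flat {φ : ℝ → ℂ} (hφ : ContDiff ℝ ∞ φ) (heven : ∀ r, φ (-r) = φ r)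
    (K : ℕ) : ∃ P : ℂ[X], ∀ j < 2 * K,
      iteratedDeriv j (fun r : ℝ => φ r - P.eval ((r : ℂ) ^ 2)) 0 = 0 := by
  classical
  -- coefficients and the two incarnations of the Taylor polynomial
  set q : ℕ → ℂ := fun k => iteratedDeriv (2 * k) φ 0 / ((2 * k).factorial : ℂ) with hq
  set P : ℂ[X] := ∑ k ∈ Finset.range K, C (q k) * X ^ k with hP
  set Pr : ℂ[X] := ∑ k ∈ Finset.range K, C (q k) * X ^ (2 * k) with hPr
  have hPPr : ∀ r : ℝ, P.eval ((r : ℂ) ^ 2) = Pr.eval (r : ℂ) := fun r => by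
    simp only [hP, hPr, eval_finsetSum, eval_mul, eval_C, eval_pow, eval_X, ← pow_mul]
  have hcoeff : ∀ j, Pr.coeff j = ∑ k ∈ Finset.range K, if j = 2 * k then q k else 0 := fun j => by
    simp only [hPr, finsetSum_coeff, coeff_C_mul_X_pow]
  refine ⟨P, fun j hj => ?_⟩
  have hT : ContDiff ℝ ∞ fun r : ℝ => P.eval ((r : ℂ) ^ 2) := by
    have : (fun r : ℝ => P.eval ((r : ℂ) ^ 2)) = fun r : ℝ => Pr.eval (r : ℂ) := funext hPPr
    rw [this]; exact contDiff_polynomial_eval_ofReal Pr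
  have hsub : iteratedDeriv j (fun r : ℝ => φ r - P.eval ((r : ℂ) ^ 2)) 0 =
      iteratedDeriv j φ 0 - iteratedDeriv j (fun r : ℝ => P.eval ((r : ℂ) ^ 2)) 0 := by
    have h := iteratedDeriv_sub (n := j) (x := (0 : ℝ)) (hφ.contDiffAt.of_le (mod_cast le_top))
      (hT.contDiffAt.of_le (mod_cast le_top))
    exact h
  rw [hsub, show (fun r : ℝ => P.eval ((r : ℂ) ^ 2)) = fun r : ℝ => Pr.eval (r : ℂ) from funext hPPr,
    iteratedDeriv_polynomial_eval_ofReal_zero, hcoeff]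
  rcases Nat.even_or_odd j with ⟨k, hk⟩ | hodd
  · -- even order `j = 2k`, `k < K`: the sum picks out `q k`
    have hk2 : j = 2 * k := by omega
    have hkK : k < K := by omega
    rw [Finset.sum_eq_single k (fun b _ hb => if_neg (by omega)) (fun hk' => absurd
      (Finset.mem_range.2 hkK) hk'), if_pos hk2, hq]
    simp only [hk2]
    have hf : ((2 * k).factorial : ℂ) ≠ 0 := by exact_mod_cast Nat.factorial_ne_zero _
    rw [mul_div_assoc', mul_div_cancel_left₀ _ hf, sub_self]
  · -- odd order: everything vanishes
    rw [iteratedDeriv_eq_zero_of_even heven hodd, Finset.sum_eq_zero (fun k _ => if_neg ?_)]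
    · simp
    · rintro rfl; exact (Nat.not_even_iff_odd.2 hodd) (even_two_mul k)

/-! ## The radial profile of a radial Schwartz function -/

variable {d : ℕ} [NeZero d]

/-- The profile `r ↦ f(r e₀)` of a Schwartz function is smooth. [folklore] -/
theorem contDiff_profile (f : 𝓢(EuclideanSpace ℝ (Fin d), ℂ)) :
    ContDiff ℝ ∞ fun r : ℝ => f (axisPt d r) := by
  have h : (fun r : ℝ => f (axisPt d r)) = f ∘ fun r : ℝ => r • axisPt d 1 := by
    funext r; simp [axisPt_eq_smul r]
  rw [h]
  exact (f.smooth ⊤).comp (contDiff_id.smul contDiff_const)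

/-- The profile of a radial function is even. [folklore] -/
theorem profile_even {f : EuclideanSpace ℝ (Fin d) → ℂ} (hf : IsRadial f) (r : ℝ) :
    f (axisPt d (-r)) = f (axisPt d r) :=
  hf (by simp)

/-! ## The cut-off and the function `H` -/

/-- A smooth cut-off `θ` with `θ = 1` on `[0, ∞)` and `θ = 0` on `(−∞, −1]`:
`θ(s) = smoothTransition(s + 1)`. [folklore] -/
theorem smoothTransition_add_one_of_nonneg {s : ℝ} (hs : 0 ≤ s) : Real.smoothTransition (s + 1) = 1 :=
  Real.smoothTransition.one_of_one_le (by linarith)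

/-- `θ(s) = 0` for `s ≤ −1`. [folklore] -/
theorem smoothTransition_add_one_of_le {s : ℝ} (hs : s ≤ -1) : Real.smoothTransition (s + 1) = 0 :=
  Real.smoothTransition.zero_of_nonpos (by linarith)

/-- **The representation of a compactly supported radial Schwartz function as a Gaussian
superposition** (CKMRV, proof of Lemma 2.2: "every compactly supported, smooth, radial `f` on `ℝᵈ`
can be written as `f(x) = g(|x|²) e^{−πy|x|²}` where `g` is a smooth, compactly supported function
on `ℝ` … `f(x) = lim_{T→∞} ∫_{−T}^{T} ĝ(t) e^{πi(2t+iy)|x|²} dt`"), in quantitative form: for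
every radial Schwartz `f` on `ℝᵈ` vanishing for `|x| ≥ R`, every real `y` (in the application
`y > 0`) and every `k ∈ ℕ` there
is an integrable weight `w : ℝ → ℂ` with `∫ (1 + |t|)ᵏ |w(t)| dt < ∞` such that
`f(x) = ∫ w(t) e^{πi(2t+iy)|x|²} dt` for all `x`. (Here `g` is only taken `C^{k+2}`, which is what
a finite-order even-function lemma provides, and `w = 𝓕(e^{πys} g)`.) [cite: CohnEtAl2019, §2.3 Lemma 2.2 (proof)] -/
theorem exists_gaussSup_eq (f : 𝓢(EuclideanSpace ℝ (Fin d), ℂ)) (hrad : IsRadial f) {R : ℝ}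
    (hR : 0 ≤ R) (hsupp : ∀ x, R ≤ ‖x‖ → f x = 0) (y : ℝ) (k : ℕ) :
    ∃ w : ℝ → ℂ, Integrable w ∧ Integrable (fun t : ℝ => (1 + |t|) ^ k * ‖w t‖) ∧
      ∀ x, f x = gaussSup w y x := by
  -- the even profile and its flat remainder
  set φ : ℝ → ℂ := fun r => f (axisPt d r) with hφ
  have hφs : ContDiff ℝ ∞ φ := contDiff_profile f
  have hφe : ∀ r, φ (-r) = φ r := fun r => profile_even hrad r
  have hφ0 : ∀ r, R ≤ |r| → φ r = 0 := fun r hr => hsupp _ (by simpa using hr)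
  have hfφ : ∀ x, f x = φ ‖x‖ := fun x => hrad.apply_eq_radialValue x
  set m : ℕ := k + 2 with hm
  obtain ⟨P, hP⟩ := exists_polynomial_sub_flat hφs hφe (2 * m + 2)
  set ρ : ℝ → ℂ := fun r => φ r - P.eval ((r : ℂ) ^ 2) with hρ
  have hρs : ContDiff ℝ ∞ ρ := hφs.sub (contDiff_polynomial_eval_ofReal_sq P)
  have hflat : ∀ j < 4 * m + 4, iteratedDeriv j ρ 0 = 0 := fun j hj => hP j (by omega)
  have hρ0 : ρ 0 = 0 := by simpa using hflat 0 (by omega)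
  -- `s ↦ ρ(√s)` is `C^m`
  have hg : ContDiff ℝ m fun s : ℝ => ρ (Real.sqrt s) := contDiff_comp_sqrt_of_flat hρs m hflat
  -- the function `h` with `h(|x|²) = f(x)` and its damped version `H`
  set h : ℝ → ℂ := fun s =>
    (Real.smoothTransition (s + 1) : ℂ) * P.eval (s : ℂ) + ρ (Real.sqrt s) with hh
  set H : ℝ → ℂ := fun s => cexp ((Real.pi * y * s : ℝ)) * h s with hH
  have hh_nonneg : ∀ s, 0 ≤ s → h s = φ (Real.sqrt s) := fun s hs => by
    simp only [hh, hρ, smoothTransition_add_one_of_nonneg hs, Complex.ofReal_one, one_mul]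
    rw [← Complex.ofReal_pow, Real.sq_sqrt hs]
    ring
  have hh_sq : ∀ x : EuclideanSpace ℝ (Fin d), h (‖x‖ ^ 2) = f x := fun x => by
    rw [hh_nonneg _ (sq_nonneg _), Real.sqrt_sq (norm_nonneg _), hfφ]
  have hθs : ContDiff ℝ ∞ fun s : ℝ => ((Real.smoothTransition (s + 1) : ℝ) : ℂ) :=
    Complex.ofRealCLM.contDiff.comp (Real.smoothTransition.contDiff.comp
      (contDiff_id.add contDiff_const))
  have hhs : ContDiff ℝ m h :=
    ((hθs.of_le (mod_cast le_top)).mul ((contDiff_polynomial_eval_ofReal P).of_le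
      (mod_cast le_top))).add hg
  have hexp : ContDiff ℝ ∞ fun s : ℝ => cexp ((Real.pi * y * s : ℝ)) :=
    Complex.contDiff_exp.comp (Complex.ofRealCLM.contDiff.comp (contDiff_const.mul contDiff_id))
  have hHs : ContDiff ℝ m H := (hexp.of_le (mod_cast le_top)).mul hhs
  have hHc : HasCompactSupport H := by
    refine HasCompactSupport.intro (isCompact_Icc (a := (-1 : ℝ)) (b := R ^ 2)) fun s hs => ?_
    simp only [mem_Icc, not_and_or, not_le] at hs
    simp only [hH]
    rcases hs with hs | hs
    · -- `s < -1`: the cut-off vanishes and `√s = 0`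
      simp only [hh, smoothTransition_add_one_of_le hs.le, Complex.ofReal_zero, zero_mul, zero_add,
        Real.sqrt_eq_zero'.2 (by linarith : s ≤ 0), hρ0, mul_zero]
    · -- `s > R²`: `h s = φ(√s) = 0`
      have hs0 : 0 ≤ s := le_trans (sq_nonneg R) hs.le
      rw [hh_nonneg s hs0, hφ0 _ ?_, mul_zero]
      rw [abs_of_nonneg (Real.sqrt_nonneg _), ← Real.sqrt_sq hR]
      exact Real.sqrt_le_sqrt hs.le
  -- the weight
  refine ⟨𝓕 H, integrable_fourier_of_contDiff hHs hHc (by omega),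
    integrable_one_add_abs_pow_mul_norm_fourier hHs hHc (by omega), fun x => ?_⟩
  -- the representation: invert `H` at `s = |x|²`
  have hinv := eq_integral_fourier_mul_cexp hHs hHc (by omega) (‖x‖ ^ 2)
  have hHx : H (‖x‖ ^ 2) = cexp ((Real.pi * y * ‖x‖ ^ 2 : ℝ)) * f x := by
    simp only [hH, hh_sq]
  rw [gaussSup_def]
  have key : ∀ t : ℝ, cexp (Real.pi * I * lineH y t * ‖x‖ ^ 2) =
      cexp (2 * Real.pi * I * t * (‖x‖ ^ 2 : ℝ)) * cexp (-(Real.pi * y * ‖x‖ ^ 2 : ℝ)) := by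
    intro t
    rw [← Complex.exp_add]
    congr 1
    simp only [lineH]
    push_cast
    ring_nf
    rw [I_sq]
    ring
  have hsplit : ∀ t : ℝ, 𝓕 H t * cexp (Real.pi * I * lineH y t * ‖x‖ ^ 2) =
      𝓕 H t * cexp (2 * Real.pi * I * t * (‖x‖ ^ 2 : ℝ)) * cexp (-(Real.pi * y * ‖x‖ ^ 2 : ℝ)) := by
    intro t
    rw [key t]
    ring
  simp_rw [hsplit]
  rw [integral_mul_const, ← hinv, hHx, mul_comm (cexp _) (f x), mul_assoc, ← Complex.exp_add]
  simp

end Literature.Analysis.Fourier
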